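import Literature.NumberTheory.K2Lit.SiegelEisensteinSeriesDoubled
import HarnessLib

/-!
# Meromorphic continuation, order and poles of the family `s ↦ E(h; f_s)` on the doubled unitary group

Topic `NumberTheory/K2Lit` (Track B build stream 29; planner `hodgecm-mathlib-K2Liu-plan`, SIG TABLE rows #8 ∕ #20 of
`Cruxes/HLiu418/Lines/K2_Liu_CurveThetaSigs.md`; the POLE CARRIER asked for by the tier-0 line writer `A-plan2` (g33) and by
the chair's S-B(♯) organs O1 «at most a simple pole at s = ½» ∕ O4 «E(·, s, f_Φ″) has a pole at ½»). Definitions and proved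
lemmas only: **no `sorry`, no named fact, no instance, no notation.**

Over ★ `K2Lit/SiegelEisensteinSeriesDoubled` (`eisensteinFamilyDelta f s h = E(h; f_s) = ∑_{γ ∈ P_Δ(L⁺)\H(L⁺)} f_s(γ h)`, absolutely
convergent for `Re s > n/2` on `H = U(n, n)`, junk `0` elsewhere) this file gives the carrier-level notions the line's pole
statements are typed over, WITHOUT positing analytic continuation:

* `IsEisensteinContinuation f h E`: `E : ℂ → ℂ` is meromorphic on all of `ℂ` (Mathlib `Meromorphic`) and agrees with
  `s ↦ E(h; f_s)` on the open half-plane `Re s > n/2`;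
* **well-definedness** `IsEisensteinContinuation.meromorphicOrderAt_eq` (PROVED, identity principle on the connected `ℂ`):
  two continuations have the same `meromorphicOrderAt` at every point — so the order of `E(h; f_s)` at `s₀` read off ANY
  continuation is one number;
* `eisensteinOrderAt f h s₀ : WithTop ℤ` (that number; junk `⊤` = «locally zero» when no continuation exists), `HasPoleAt f s₀`
  (`∃ h`, order `< 0`), `IsHolomorphicAt`, `AtMostSimplePoleAt` (order `≥ −1` for every `h`, O1), `IsResidueAt f s₀ r`
  (`(s − s₀)·E(h; f_s) → r h`, the input shape of a first-term ∕ Siegel–Weil residue identity, O5 ∕ S-A s4);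
* sanity: `HasPoleAt → ¬ IsHolomorphicAt`, `eisensteinOrderAt_eq` (order = order of any continuation).

A family with no continuation (e.g. a wild, non-holomorphic family of sections) has NO pole and every `IsResidueAt` about it is
about nothing — pole ASSERTIONS therefore always come with the standard-section ∕ summability hypotheses of the SIG TABLE (#9),
never bare. References: V. Tan, Canad. J. Math. 51 (1999) 164–175 §§1–3 [Tan1999]; Y. Liu, Invent. Math. 228 (2022) Lem. B.10
p. 102; S. Kudla, S. Rallis, Ann. of Math. 140 (1994) §1 (first-term identities; WANT acq-06809).
-/

noncomputable section

open scoped Topology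
open Filter NumberField

namespace Literature.NumberTheory.K2Lit.SiegelDoubled

open Literature.NumberTheory.Automorphic Literature.NumberTheory.GaloisRepresentations
open Literature.NumberTheory.GelbartRogawski1991 Literature.NumberTheory.GelbartRogawski1991.GRConstruction

variable (L : Type) [Field L] [NumberField L] [IsCMField L]
variable {N M n : ℕ} (e : Fin N × Fin M ≃ Fin n)
  (dV : Fin N → L) (hdV : ∀ i, IsCMField.complexConj L (dV i) = dV i)
  (dW : Fin M → L) (hdW : ∀ i, IsCMField.complexConj L (dW i) = dW i)

/-! ## 1. Meromorphic continuations of `s ↦ E(h; f_s)` and the identity principle -/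

/-- **`E` is a meromorphic continuation of `s ↦ E(h; f_s)`**: meromorphic on all of `ℂ` and equal to the (absolutely convergent)
Eisenstein series on the half-plane `Re s > n/2`. [cite: Tan1999, §1] [cite: Liu2021, Lem. B.10 (2) p. 102] -/
def IsEisensteinContinuation (f : ℂ → HA L e dV hdV dW hdW → ℂ) (h : HA L e dV hdV dW hdW) (E : ℂ → ℂ) : Prop :=
  Meromorphic E ∧ ∀ s : ℂ, (n : ℝ) / 2 < s.re → E s = eisensteinFamilyDelta L e dV hdV dW hdW f s h

/-- `s ↦ E(h; f_s)` **admits a meromorphic continuation** for every `h`. [cite: Tan1999, §1] -/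
def HasEisensteinContinuation (f : ℂ → HA L e dV hdV dW hdW → ℂ) : Prop :=
  ∀ h : HA L e dV hdV dW hdW, ∃ E : ℂ → ℂ, IsEisensteinContinuation L e dV hdV dW hdW f h E

/-- **Identity principle on a half-plane**: two functions meromorphic on `ℂ` that agree on `Re s > a` have the same
`meromorphicOrderAt` everywhere (`g₁ − g₂` vanishes near `a + 1`, hence — `ℂ` being connected — near every point).
[cite: Tan1999, §1] -/
theorem meromorphicOrderAt_eq_of_eqOn_halfPlane {g₁ g₂ : ℂ → ℂ} (hg₁ : Meromorphic g₁) (hg₂ : Meromorphic g₂) (a : ℝ)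
    (h : ∀ s : ℂ, a < s.re → g₁ s = g₂ s) (z : ℂ) : meromorphicOrderAt g₁ z = meromorphicOrderAt g₂ z := by
  have hsub : Meromorphic (g₁ - g₂) := hg₁.sub hg₂
  have ha : meromorphicOrderAt (g₁ - g₂) ((a + 1 : ℝ) : ℂ) = ⊤ := by
    rw [meromorphicOrderAt_eq_top_iff]
    have hopen : IsOpen {s : ℂ | a < s.re} := isOpen_lt continuous_const Complex.continuous_re
    have hmem : ((a + 1 : ℝ) : ℂ) ∈ {s : ℂ | a < s.re} := by simp
    filter_upwards [nhdsWithin_le_nhds (hopen.mem_nhds hmem)] with s hs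
    simp [Pi.sub_apply, h s hs]
  have hall : ∀ w : ℂ, meromorphicOrderAt (g₁ - g₂) w = ⊤ := by
    by_contra hcon
    push Not at hcon
    obtain ⟨w, hw⟩ := hcon
    exact ((hsub.meromorphicOn (s := Set.univ)).exists_meromorphicOrderAt_ne_top_iff_forall_mem
      isConnected_univ).1 ⟨w, Set.mem_univ w, hw⟩ _ (Set.mem_univ _) ha
  refine meromorphicOrderAt_congr ?_
  filter_upwards [meromorphicOrderAt_eq_top_iff.1 (hall z)] with s hs
  simpa [sub_eq_zero] using hs

variable {L e dV hdV dW hdW} in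
/-- **The order of `E(h; f_s)` at `s₀` does not depend on the continuation.** [cite: Tan1999, §1] -/
theorem IsEisensteinContinuation.meromorphicOrderAt_eq {f : ℂ → HA L e dV hdV dW hdW → ℂ} {h : HA L e dV hdV dW hdW}
    {E₁ E₂ : ℂ → ℂ} (h₁ : IsEisensteinContinuation L e dV hdV dW hdW f h E₁)
    (h₂ : IsEisensteinContinuation L e dV hdV dW hdW f h E₂) (z : ℂ) :
    meromorphicOrderAt E₁ z = meromorphicOrderAt E₂ z :=
  meromorphicOrderAt_eq_of_eqOn_halfPlane h₁.1 h₂.1 ((n : ℝ) / 2) (fun s hs => by rw [h₁.2 s hs, h₂.2 s hs]) z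

/-! ## 2. Order, poles, holomorphy, residues -/

open Classical in
/-- **`ord_{s = s₀} E(h; f_s)`** — the `meromorphicOrderAt` of any continuation (well defined by
`IsEisensteinContinuation.meromorphicOrderAt_eq`); junk `⊤` («vanishes identically near s₀») when `s ↦ E(h; f_s)` has no
meromorphic continuation. [cite: Tan1999, §3] -/
def eisensteinOrderAt (f : ℂ → HA L e dV hdV dW hdW → ℂ) (h : HA L e dV hdV dW hdW) (s₀ : ℂ) : WithTop ℤ :=
  if hE : ∃ E : ℂ → ℂ, IsEisensteinContinuation L e dV hdV dW hdW f h E then meromorphicOrderAt hE.choose s₀ else ⊤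

variable {L e dV hdV dW hdW} in
/-- The order is the order of ANY continuation. [cite: Tan1999, §3] -/
theorem IsEisensteinContinuation.eisensteinOrderAt_eq {f : ℂ → HA L e dV hdV dW hdW → ℂ} {h : HA L e dV hdV dW hdW}
    {E : ℂ → ℂ} (hE : IsEisensteinContinuation L e dV hdV dW hdW f h E) (s₀ : ℂ) :
    eisensteinOrderAt L e dV hdV dW hdW f h s₀ = meromorphicOrderAt E s₀ := by
  have hex : ∃ E : ℂ → ℂ, IsEisensteinContinuation L e dV hdV dW hdW f h E := ⟨E, hE⟩
  rw [eisensteinOrderAt, dif_pos hex]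
  exact hex.choose_spec.meromorphicOrderAt_eq hE s₀

/-- Without a continuation the order is the junk value `⊤`. [cite: Tan1999, §3] -/
theorem eisensteinOrderAt_of_not_exists {f : ℂ → HA L e dV hdV dW hdW → ℂ} {h : HA L e dV hdV dW hdW}
    (hf : ¬ ∃ E : ℂ → ℂ, IsEisensteinContinuation L e dV hdV dW hdW f h E) (s₀ : ℂ) :
    eisensteinOrderAt L e dV hdV dW hdW f h s₀ = ⊤ := by
  rw [eisensteinOrderAt, dif_neg hf]

/-- **`E(·; f_s)` has a pole at `s₀`**: for some `h`, `ord_{s₀} E(h; f_s) < 0`. [cite: Tan1999, §3 Thm. 3.1]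
[cite: Liu2021, Lem. B.10 (2) p. 102] -/
def HasPoleAt (f : ℂ → HA L e dV hdV dW hdW → ℂ) (s₀ : ℂ) : Prop :=
  ∃ h : HA L e dV hdV dW hdW, eisensteinOrderAt L e dV hdV dW hdW f h s₀ < 0

/-- **`E(·; f_s)` is holomorphic at `s₀`**: it has continuations and `ord_{s₀} E(h; f_s) ≥ 0` for every `h`.
[cite: Tan1999, §3 Thm. 3.1] -/
def IsHolomorphicAt (f : ℂ → HA L e dV hdV dW hdW → ℂ) (s₀ : ℂ) : Prop :=
  HasEisensteinContinuation L e dV hdV dW hdW f ∧ ∀ h : HA L e dV hdV dW hdW, 0 ≤ eisensteinOrderAt L e dV hdV dW hdW f h s₀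

/-- **At most a simple pole at `s₀`** (the shape of the statement for standard sections at `s₀ = ½` on `U(2,2)`, organ O1).
[cite: Tan1999, §3 Thm. 3.1] -/
def AtMostSimplePoleAt (f : ℂ → HA L e dV hdV dW hdW → ℂ) (s₀ : ℂ) : Prop :=
  HasEisensteinContinuation L e dV hdV dW hdW f ∧ ∀ h : HA L e dV hdV dW hdW, -1 ≤ eisensteinOrderAt L e dV hdV dW hdW f h s₀

/-- **`r = Res_{s = s₀} E(·; f_s)`** as a function on `H(𝔸)`: for every `h` some (equivalently, by the identity principle, every)
continuation satisfies `(s − s₀)·E(s) → r h` as `s → s₀`, `s ≠ s₀` — the input shape of a first-term ∕ Siegel–Weil residue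
identity `Res_{s₀} E(·; f_s) = c · I(Φ′)`. [cite: Liu2021, Lem. B.10 (2) p. 102] [cite: Tan1999, §3] -/
def IsResidueAt (f : ℂ → HA L e dV hdV dW hdW → ℂ) (s₀ : ℂ) (r : HA L e dV hdV dW hdW → ℂ) : Prop :=
  ∀ h : HA L e dV hdV dW hdW, ∃ E : ℂ → ℂ, IsEisensteinContinuation L e dV hdV dW hdW f h E ∧
    Tendsto (fun s : ℂ => (s - s₀) * E s) (𝓝[≠] s₀) (𝓝 (r h))

/-! ## 3. Sanity lemmas -/

/-- A pole excludes holomorphy. [cite: Tan1999, §3 Thm. 3.1] -/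
theorem not_isHolomorphicAt_of_hasPoleAt {f : ℂ → HA L e dV hdV dW hdW → ℂ} {s₀ : ℂ}
    (hf : HasPoleAt L e dV hdV dW hdW f s₀) : ¬ IsHolomorphicAt L e dV hdV dW hdW f s₀ := by
  rintro ⟨-, h0⟩
  obtain ⟨h, hh⟩ := hf
  exact (lt_irrefl _) (lt_of_lt_of_le hh (h0 h))

/-- Holomorphy at `s₀` implies at most a simple pole at `s₀`. [cite: Tan1999, §3 Thm. 3.1] -/
theorem IsHolomorphicAt.atMostSimplePoleAt {f : ℂ → HA L e dV hdV dW hdW → ℂ} {s₀ : ℂ}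
    (hf : IsHolomorphicAt L e dV hdV dW hdW f s₀) : AtMostSimplePoleAt L e dV hdV dW hdW f s₀ :=
  ⟨hf.1, fun h => le_trans (by decide) (hf.2 h)⟩

/-- A pole at `s₀` forces `s ↦ E(h; f_s)` to have a continuation at the witnessing `h` (the order is not the junk `⊤`).
[cite: Tan1999, §3] -/
theorem HasPoleAt.exists_continuation {f : ℂ → HA L e dV hdV dW hdW → ℂ} {s₀ : ℂ}
    (hf : HasPoleAt L e dV hdV dW hdW f s₀) :
    ∃ h : HA L e dV hdV dW hdW, ∃ E : ℂ → ℂ, IsEisensteinContinuation L e dV hdV dW hdW f h E ∧ meromorphicOrderAt E s₀ < 0 := by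
  obtain ⟨h, hh⟩ := hf
  by_cases hex : ∃ E : ℂ → ℂ, IsEisensteinContinuation L e dV hdV dW hdW f h E
  · obtain ⟨E, hE⟩ := hex
    exact ⟨h, E, hE, by rwa [← hE.eisensteinOrderAt_eq s₀]⟩
  · rw [eisensteinOrderAt_of_not_exists L e dV hdV dW hdW hex s₀] at hh
    exact absurd hh (by simp)

end Literature.NumberTheory.K2Lit.SiegelDoubled
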